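import Summits.Ventures.PercRepro.Night2FatZPlanes
import Summits.Ventures.PercRepro.Night2FatXGenericTwelve

/-!
# night-2: exactly one basis point on the spine (A) — the y-restricted distance-1 lemmas

The gen-33 line-point count and level bounds with the distance-1 hypothesis asked only at the targets through `y₁`
(`card_loaded_targets_through_le_of_D1y`, `fat_count_level_ge_line_point_of_D1y`, `…'` with the capacity `1` at the top
four levels).  Paper `proofs/NIGHT-2-g34.md` §6 (b).
-/

namespace PercRepro.Shadow

open PercRepro.ThmH PercRepro.PerFlat

variable {α : Type*} [DecidableEq α] {M : Matroid α} [M.Finite] {G : Finset α}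

/-- **The loaded targets through `x` and a point `y₁` of the basis line `ℓ_ab` at level `j` number at most
`C(t₁ − 1, j − 2)`**, `t₁` the number of points of `W ∖ {x}` on `ℓ_ab`, under the distance-1 hypothesis at the targets
through `y₁`: every such load has its `Y ⊆ ℓ_ab`. -/
theorem card_loaded_targets_through_le_of_D1y (hG : G ∈ flatsQ M (5 + 1)) (hd : (gr M \ G).card = 2)
    (hk : kColoops M G = 1) (hs : ∀ e ∈ gr M, ∀ f ∈ gr M, e ≠ f → rkN M {e, f} = 2)
    (hl : ∀ e ∈ gr M, M.Indep {e}) {w₀ x : α}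
    {B : Finset α} (hB : B ∈ thinMembers M 5 G) (hnP : ¬ bigP M G B) {z : α} (hz : z ∈ G \ clF M B) {y₁ : α}
    (hD1 : ∀ T ∈ tgtSets M 5 G B z, x ∈ T → y₁ ∈ T → dload M 5 G (bigP M G) (dshGT2 M 5 G) T ≠ 0 →
      ∃ R ⊆ (T \ coloops M G) \ {w₀, x}, rkN M R = 2 ∧ 3 ≤ R.card ∧ R.card + 4 = (T \ coloops M G).card ∧
        3 ≤ rkN M (G \ T)) (hx : x ∉ insert z B) (hy₁ : y₁ ∈ (G \ insert z B).erase x) {a b : α}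
    (ha : a ∈ (insert z B \ coloops M G).erase w₀) (hb : b ∈ (insert z B \ coloops M G).erase w₀) (hab : a ≠ b)
    (hline : rkN M {a, b, y₁} ≤ 2) (j : ℕ) : ((tgtSets M 5 G B z).filter (fun T => ({x, y₁} : Finset α) ⊆ T ∧ (T \ insert z B).card = j ∧
      dload M 5 G (bigP M G) (dshGT2 M 5 G) T ≠ 0)).card ≤
      ((((G \ insert z B).erase x).filter (fun y => rkN M (insert y {a, b}) ≤ 2)).erase y₁).card.choose (j - 2) := by
  have hy₁x : y₁ ≠ x := (Finset.mem_erase.1 hy₁).1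
  have hy₁G : y₁ ∈ G \ insert z B := Finset.mem_of_mem_erase hy₁
  set L := ((G \ insert z B).erase x).filter (fun y => rkN M (insert y {a, b}) ≤ 2) with hL
  rw [← Finset.card_powersetCard]
  apply Finset.card_le_card_of_injOn (fun T => (T \ insert z B) \ {x, y₁})
  · intro T hT
    rw [Finset.mem_coe, Finset.mem_filter] at hT
    obtain ⟨hTt, hXT, hTj, hload⟩ := hT
    have hTG : T ⊆ G := subset_G_of_mem_shadowAt (mem_tgtSets.1 hTt).1
    have hxT : x ∈ T := hXT (Finset.mem_insert_self _ _)
    have hy₁T : y₁ ∈ T := hXT (Finset.mem_insert_of_mem (Finset.mem_singleton_self _))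
    -- the load is at distance one and its `Y` lies on a basis line through `y₁`, which is `ℓ_ab`
    obtain ⟨R, hR, hR2, hR3, hRc, -⟩ := hD1 T hTt hxT hy₁T hload
    obtain ⟨a', ha', b', hb', hab', hrk⟩ :=
      exists_basis_line_of_dist_one_fat hG hd hk hs hB hnP hz hTt hxT hx hR hR2 hRc
    have hy₁Y : y₁ ∈ (T \ insert z B).erase x :=
      Finset.mem_erase.2 ⟨hy₁x, Finset.mem_sdiff.2 ⟨hy₁T, (Finset.mem_sdiff.1 hy₁G).2⟩⟩
    have hsub₁ : ({a', b', y₁} : Finset α) ⊆ insert a' (insert b' ((T \ insert z B).erase x)) := by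
      intro e he
      rw [Finset.mem_insert, Finset.mem_insert, Finset.mem_singleton] at he
      rw [Finset.mem_insert, Finset.mem_insert]
      rcases he with rfl | rfl | rfl
      · exact Or.inl rfl
      · exact Or.inr (Or.inl rfl)
      · exact Or.inr (Or.inr hy₁Y)
    have hrk₁ : rkN M {a', b', y₁} ≤ 2 := by
      have := rkN_mono (M := M) hsub₁
      rw [hrk] at this
      exact this
    have hsame : ({a, b} : Finset α) = {a', b'} := by
      by_contra hne
      exact not_on_two_basis_lines hG hd hk hs hl hB hnP hz (Finset.mem_of_mem_erase ha)
        (Finset.mem_of_mem_erase hb) (Finset.mem_of_mem_erase ha') (Finset.mem_of_mem_erase hb') hab hab' hne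
        hy₁G hline hrk₁
    rw [Finset.mem_coe, Finset.mem_powersetCard]
    constructor
    · intro e he
      rw [Finset.mem_sdiff, Finset.mem_insert, Finset.mem_singleton, not_or] at he
      obtain ⟨heTQ, hex, hey₁⟩ := he
      refine Finset.mem_erase.2 ⟨hey₁, ?_⟩
      rw [hL, Finset.mem_filter]
      refine ⟨Finset.mem_erase.2 ⟨hex, Finset.sdiff_subset_sdiff hTG (Finset.Subset.refl _) heTQ⟩, ?_⟩
      have hsub₂ : insert e {a, b} ⊆ insert a' (insert b' ((T \ insert z B).erase x)) := by
        intro u hu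
        rw [Finset.mem_insert] at hu
        rcases hu with rfl | hu
        · exact Finset.mem_insert_of_mem (Finset.mem_insert_of_mem (Finset.mem_erase.2 ⟨hex, heTQ⟩))
        · rw [hsame, Finset.mem_insert, Finset.mem_singleton] at hu
          rw [Finset.mem_insert, Finset.mem_insert]
          rcases hu with rfl | rfl
          · exact Or.inl rfl
          · exact Or.inr (Or.inl rfl)
      have := rkN_mono (M := M) hsub₂
      rw [hrk] at this
      exact this
    · have hXsub : ({x, y₁} : Finset α) ⊆ T \ insert z B := by
        intro e he
        rw [Finset.mem_insert, Finset.mem_singleton] at he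
        rcases he with rfl | rfl
        · exact Finset.mem_sdiff.2 ⟨hxT, hx⟩
        · exact Finset.mem_sdiff.2 ⟨hy₁T, (Finset.mem_sdiff.1 hy₁G).2⟩
      rw [Finset.card_sdiff_of_subset hXsub, hTj, Finset.card_pair hy₁x.symm]
  · intro T₁ hT₁ T₂ hT₂ heq
    rw [Finset.mem_coe, Finset.mem_filter] at hT₁ hT₂
    have key : ∀ T ∈ tgtSets M 5 G B z, ({x, y₁} : Finset α) ⊆ T →
        T = insert z B ∪ ({x, y₁} ∪ ((T \ insert z B) \ {x, y₁})) := by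
      intro T hT hXT
      have hQT : insert z B ⊆ T := (mem_tgtSets.1 hT).2.1
      ext e
      simp only [Finset.mem_union, Finset.mem_sdiff]
      constructor
      · intro heT
        by_cases heQ : e ∈ insert z B
        · exact Or.inl heQ
        · by_cases heX : e ∈ ({x, y₁} : Finset α)
          · exact Or.inr (Or.inl heX)
          · exact Or.inr (Or.inr ⟨⟨heT, heQ⟩, heX⟩)
      · rintro (heQ | heX | ⟨⟨heT, -⟩, -⟩)
        · exact hQT heQ
        · exact hXT heX
        · exact heT
    rw [key T₁ hT₁.1 hT₁.2.1, key T₂ hT₂.1 hT₂.2.1]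
    simp only at heq
    rw [heq]

/-- **The unloaded targets through `x` and a point `y₁` of the basis line `ℓ_ab` at level `j ≥ 2`** number at
least `C(N − 2, j − 2) − C(t₁ − 1, j − 2)` (`t₁ = |W ∖ {x} ∩ ℓ_ab|`), each worth `fatTerm j (11/18)`. -/
theorem fat_count_level_ge_line_point_of_D1y (hG : G ∈ flatsQ M (5 + 1)) (hd : (gr M \ G).card = 2)
    (hk : kColoops M G = 1) (hs : ∀ e ∈ gr M, ∀ f ∈ gr M, e ≠ f → rkN M {e, f} = 2)
    (hl : ∀ e ∈ gr M, M.Indep {e}) {B₀ : Finset α}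
    {w₀ x : α} (hD : G \ clF M B₀ = {w₀, x}) {B : Finset α} (hB : B ∈ thinMembers M 5 G) (hnP : ¬ bigP M G B) {z : α} (hz : z ∈ G \ clF M B) {y₁ : α}
    (hD1 : ∀ T ∈ tgtSets M 5 G B z, x ∈ T → y₁ ∈ T → dload M 5 G (bigP M G) (dshGT2 M 5 G) T ≠ 0 →
      ∃ R ⊆ (T \ coloops M G) \ {w₀, x}, rkN M R = 2 ∧ 3 ≤ R.card ∧ R.card + 4 = (T \ coloops M G).card ∧
        3 ≤ rkN M (G \ T)) (hx : x ∈ G \ insert z B) (hy₁ : y₁ ∈ (G \ insert z B).erase x) {a b : α}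
    (ha : a ∈ (insert z B \ coloops M G).erase w₀) (hb : b ∈ (insert z B \ coloops M G).erase w₀) (hab : a ≠ b)
    (hline : rkN M {a, b, y₁} ≤ 2) {j : ℕ} (hj : 2 ≤ j) :
    ((((G \ insert z B).card - 2).choose (j - 2) -
      ((((G \ insert z B).erase x).filter (fun y => rkN M (insert y {a, b}) ≤ 2)).erase y₁).card.choose (j - 2) : ℕ) : ℚ) *
      fatTerm j (11 / 18) ≤   ∑ T ∈ ((tgtSets M 5 G B z).filter
        (fun T => x ∈ T ∧ dload M 5 G (bigP M G) (dshGT2 M 5 G) T = 0)).filter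
        (fun T => (T \ insert z B).card = j),
        capS M 5 G T / ((221 / 360 : ℚ) * ((2 * ((T \ coloops M G).card - 2).choose 4 : ℕ) : ℚ)) := by
  have hd' : (gr M \ G).card ≤ 5 := by omega
  have hy₁x : y₁ ≠ x := (Finset.mem_erase.1 hy₁).1
  have hX : ({x, y₁} : Finset α) ⊆ G \ insert z B := by
    intro e he
    rw [Finset.mem_insert, Finset.mem_singleton] at he
    rcases he with rfl | rfl
    · exact hx
    · exact Finset.mem_of_mem_erase hy₁
  have hX2 : ({x, y₁} : Finset α).card = 2 := Finset.card_pair hy₁x.symm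
  have hcount := choose_le_card_targets_level hG hB hz hX (by omega : 1 ≤ j) (by rw [hX2]; exact hj)
  rw [hX2] at hcount
  set A := (tgtSets M 5 G B z).filter (fun T => ({x, y₁} : Finset α) ⊆ T ∧ (T \ insert z B).card = j) with hA
  have hsplit := Finset.card_filter_add_card_filter_not
    (s := A) (fun T => dload M 5 G (bigP M G) (dshGT2 M 5 G) T = 0)
  have hloaded := card_loaded_targets_through_le_of_D1y hG hd hk hs hl hB hnP hz hD1
    (Finset.mem_sdiff.1 hx).2 hy₁ ha hb hab hline j
  have hloadsub : A.filter (fun T => ¬ dload M 5 G (bigP M G) (dshGT2 M 5 G) T = 0) ⊆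
      (tgtSets M 5 G B z).filter (fun T => ({x, y₁} : Finset α) ⊆ T ∧ (T \ insert z B).card = j ∧
        dload M 5 G (bigP M G) (dshGT2 M 5 G) T ≠ 0) := by
    intro T hT
    rw [Finset.mem_filter, hA, Finset.mem_filter] at hT
    rw [Finset.mem_filter]
    exact ⟨hT.1.1, hT.1.2.1, hT.1.2.2, hT.2⟩
  have hl' := le_trans (Finset.card_le_card hloadsub) hloaded
  set F := ((tgtSets M 5 G B z).filter
    (fun T => x ∈ T ∧ dload M 5 G (bigP M G) (dshGT2 M 5 G) T = 0)).filter
    (fun T => (T \ insert z B).card = j) with hF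
  have hsub : A.filter (fun T => dload M 5 G (bigP M G) (dshGT2 M 5 G) T = 0) ⊆ F := by
    intro T hT
    rw [Finset.mem_filter, hA, Finset.mem_filter] at hT
    rw [hF, Finset.mem_filter, Finset.mem_filter]
    exact ⟨⟨hT.1.1, hT.1.2.1 (Finset.mem_insert_self _ _), hT.2⟩, hT.1.2.2⟩
  have hcardU : (((G \ insert z B).card - 2).choose (j - 2) -
      ((((G \ insert z B).erase x).filter (fun y => rkN M (insert y {a, b}) ≤ 2)).erase y₁).card.choose (j - 2) : ℕ) ≤
      (A.filter (fun T => dload M 5 G (bigP M G) (dshGT2 M 5 G) T = 0)).card := by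
    omega
  have hterm : ∀ T ∈ F, fatTerm j (11 / 18) ≤
      capS M 5 G T / ((221 / 360 : ℚ) * ((2 * ((T \ coloops M G).card - 2).choose 4 : ℕ) : ℚ)) := by
    intro T hT
    rw [hF, Finset.mem_filter, Finset.mem_filter] at hT
    obtain ⟨⟨hTt, -, -⟩, hTj⟩ := hT
    have hTG : T ⊆ G := subset_G_of_mem_shadowAt (mem_tgtSets.1 hTt).1
    have hTK : (T \ coloops M G).card = j + 5 := by
      rw [card_sdiff_coloops_eq_level_add_five hG hd hk hB hnP hz hTt, hTj]
    unfold fatTerm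
    rw [hTK, show j + 5 - 2 = j + 3 by omega]
    apply div_le_div_of_nonneg_right (capS_ge_eleven_eighteenths_two_one hd hk hTG)
    positivity
  have hpos : 0 ≤ fatTerm j (11 / 18) := by
    unfold fatTerm
    positivity
  calc ((((G \ insert z B).card - 2).choose (j - 2) -
        ((((G \ insert z B).erase x).filter (fun y => rkN M (insert y {a, b}) ≤ 2)).erase y₁).card.choose (j - 2) : ℕ) : ℚ) *
        fatTerm j (11 / 18)
      ≤ ((A.filter (fun T => dload M 5 G (bigP M G) (dshGT2 M 5 G) T = 0)).card : ℚ) * fatTerm j (11 / 18) := by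
        apply mul_le_mul_of_nonneg_right _ hpos
        exact_mod_cast hcardU
    _ = ∑ _T ∈ A.filter (fun T => dload M 5 G (bigP M G) (dshGT2 M 5 G) T = 0), fatTerm j (11 / 18) := by
        rw [Finset.sum_const, nsmul_eq_mul]
    _ ≤ ∑ T ∈ A.filter (fun T => dload M 5 G (bigP M G) (dshGT2 M 5 G) T = 0),
        capS M 5 G T / ((221 / 360 : ℚ) * ((2 * ((T \ coloops M G).card - 2).choose 4 : ℕ) : ℚ)) :=
        Finset.sum_le_sum (fun T hT => hterm T (hsub hT))
    _ ≤ _ := by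
        apply Finset.sum_le_sum_of_subset_of_nonneg hsub
        intro T _ _
        exact div_nonneg (capS_nonneg' hG hd' T) (by positivity)

/-- The level bound through a point of a basis line, with the capacity `1` at the top four levels. -/
theorem fat_count_level_ge_line_point_of_D1y' (hG : G ∈ flatsQ M (5 + 1)) (hd : (gr M \ G).card = 2)
    (hk : kColoops M G = 1) (hs : ∀ e ∈ gr M, ∀ f ∈ gr M, e ≠ f → rkN M {e, f} = 2)
    (hl : ∀ e ∈ gr M, M.Indep {e}) {B₀ : Finset α}
    {w₀ x : α} (hD : G \ clF M B₀ = {w₀, x}) {B : Finset α} (hB : B ∈ thinMembers M 5 G) (hnP : ¬ bigP M G B) {z : α} (hz : z ∈ G \ clF M B) {y₁ : α}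
    (hD1 : ∀ T ∈ tgtSets M 5 G B z, x ∈ T → y₁ ∈ T → dload M 5 G (bigP M G) (dshGT2 M 5 G) T ≠ 0 →
      ∃ R ⊆ (T \ coloops M G) \ {w₀, x}, rkN M R = 2 ∧ 3 ≤ R.card ∧ R.card + 4 = (T \ coloops M G).card ∧
        3 ≤ rkN M (G \ T)) (hx : x ∈ G \ insert z B) (hy₁ : y₁ ∈ (G \ insert z B).erase x) {a b : α}
    (ha : a ∈ (insert z B \ coloops M G).erase w₀) (hb : b ∈ (insert z B \ coloops M G).erase w₀) (hab : a ≠ b)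
    (hline : rkN M {a, b, y₁} ≤ 2) {j : ℕ} (hj : 2 ≤ j) :
    ((((G \ insert z B).card - 2).choose (j - 2) -
      ((((G \ insert z B).erase x).filter (fun y => rkN M (insert y {a, b}) ≤ 2)).erase y₁).card.choose (j - 2) : ℕ) : ℚ) *
      fatTerm j (if (G \ insert z B).card - j ≤ 3 then 1 else 11 / 18) ≤
      ∑ T ∈ ((tgtSets M 5 G B z).filter     (fun T => x ∈ T ∧ dload M 5 G (bigP M G) (dshGT2 M 5 G) T = 0)).filter
        (fun T => (T \ insert z B).card = j),
        capS M 5 G T / ((221 / 360 : ℚ) * ((2 * ((T \ coloops M G).card - 2).choose 4 : ℕ) : ℚ)) := by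
  have hd' : (gr M \ G).card ≤ 5 := by omega
  have hy₁x : y₁ ≠ x := (Finset.mem_erase.1 hy₁).1
  have hX : ({x, y₁} : Finset α) ⊆ G \ insert z B := by
    intro e he
    rw [Finset.mem_insert, Finset.mem_singleton] at he
    rcases he with rfl | rfl
    · exact hx
    · exact Finset.mem_of_mem_erase hy₁
  have hX2 : ({x, y₁} : Finset α).card = 2 := Finset.card_pair hy₁x.symm
  have hcount := choose_le_card_targets_level hG hB hz hX (by omega : 1 ≤ j) (by rw [hX2]; exact hj)
  rw [hX2] at hcount
  set A := (tgtSets M 5 G B z).filter (fun T => ({x, y₁} : Finset α) ⊆ T ∧ (T \ insert z B).card = j) with hA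
  have hsplit := Finset.card_filter_add_card_filter_not
    (s := A) (fun T => dload M 5 G (bigP M G) (dshGT2 M 5 G) T = 0)
  have hloaded := card_loaded_targets_through_le_of_D1y hG hd hk hs hl hB hnP hz hD1
    (Finset.mem_sdiff.1 hx).2 hy₁ ha hb hab hline j
  have hloadsub : A.filter (fun T => ¬ dload M 5 G (bigP M G) (dshGT2 M 5 G) T = 0) ⊆
      (tgtSets M 5 G B z).filter (fun T => ({x, y₁} : Finset α) ⊆ T ∧ (T \ insert z B).card = j ∧
        dload M 5 G (bigP M G) (dshGT2 M 5 G) T ≠ 0) := by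
    intro T hT
    rw [Finset.mem_filter, hA, Finset.mem_filter] at hT
    rw [Finset.mem_filter]
    exact ⟨hT.1.1, hT.1.2.1, hT.1.2.2, hT.2⟩
  have hl' := le_trans (Finset.card_le_card hloadsub) hloaded
  set F := ((tgtSets M 5 G B z).filter
    (fun T => x ∈ T ∧ dload M 5 G (bigP M G) (dshGT2 M 5 G) T = 0)).filter
    (fun T => (T \ insert z B).card = j) with hF
  set c : ℚ := if (G \ insert z B).card - j ≤ 3 then 1 else 11 / 18 with hc
  have hsub : A.filter (fun T => dload M 5 G (bigP M G) (dshGT2 M 5 G) T = 0) ⊆ F := by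
    intro T hT
    rw [Finset.mem_filter, hA, Finset.mem_filter] at hT
    rw [hF, Finset.mem_filter, Finset.mem_filter]
    exact ⟨⟨hT.1.1, hT.1.2.1 (Finset.mem_insert_self _ _), hT.2⟩, hT.1.2.2⟩
  have hcardU : (((G \ insert z B).card - 2).choose (j - 2) -
      ((((G \ insert z B).erase x).filter (fun y => rkN M (insert y {a, b}) ≤ 2)).erase y₁).card.choose (j - 2) : ℕ) ≤
      (A.filter (fun T => dload M 5 G (bigP M G) (dshGT2 M 5 G) T = 0)).card := by
    omega
  have hterm : ∀ T ∈ F, fatTerm j c ≤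
      capS M 5 G T / ((221 / 360 : ℚ) * ((2 * ((T \ coloops M G).card - 2).choose 4 : ℕ) : ℚ)) := by
    intro T hT
    rw [hF, Finset.mem_filter, Finset.mem_filter] at hT
    obtain ⟨⟨hTt, -, -⟩, hTj⟩ := hT
    have hTG : T ⊆ G := subset_G_of_mem_shadowAt (mem_tgtSets.1 hTt).1
    have hTK : (T \ coloops M G).card = j + 5 := by
      rw [card_sdiff_coloops_eq_level_add_five hG hd hk hB hnP hz hTt, hTj]
    have hGT := card_sdiff_add_card_sdiff_of_mem_tgtSets hTt
    have hcap : c ≤ capS M 5 G T := by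
      rw [hc]
      split_ifs with h3
      · rw [capS_eq_one_of_card_sdiff_le_three hd (by omega)]
      · exact capS_ge_eleven_eighteenths_two_one hd hk hTG
    unfold fatTerm
    rw [hTK, show j + 5 - 2 = j + 3 by omega]
    apply div_le_div_of_nonneg_right hcap
    positivity
  have hpos : 0 ≤ fatTerm j c := by
    unfold fatTerm
    rw [hc]
    split_ifs <;> positivity
  calc ((((G \ insert z B).card - 2).choose (j - 2) -
        ((((G \ insert z B).erase x).filter (fun y => rkN M (insert y {a, b}) ≤ 2)).erase y₁).card.choose (j - 2) : ℕ) : ℚ) *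
        fatTerm j c
      ≤ ((A.filter (fun T => dload M 5 G (bigP M G) (dshGT2 M 5 G) T = 0)).card : ℚ) * fatTerm j c := by
        apply mul_le_mul_of_nonneg_right _ hpos
        exact_mod_cast hcardU
    _ = ∑ _T ∈ A.filter (fun T => dload M 5 G (bigP M G) (dshGT2 M 5 G) T = 0), fatTerm j c := by
        rw [Finset.sum_const, nsmul_eq_mul]
    _ ≤ ∑ T ∈ A.filter (fun T => dload M 5 G (bigP M G) (dshGT2 M 5 G) T = 0),
        capS M 5 G T / ((221 / 360 : ℚ) * ((2 * ((T \ coloops M G).card - 2).choose 4 : ℕ) : ℚ)) :=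
        Finset.sum_le_sum (fun T hT => hterm T (hsub hT))
    _ ≤ _ := by
        apply Finset.sum_le_sum_of_subset_of_nonneg hsub
        intro T _ _
        exact div_nonneg (capS_nonneg' hG hd' T) (by positivity)

end PercRepro.Shadow
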